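import Summits.CriticalPhenomena.PercolationContinuityZ3.Theorems.PercNearOneGluingNoHeavyLowerTailKNGoodGMgcSideFrame
import HarnessLib

/-!
# Side glue: a deterministic side configuration of THEOREM B's `K` glues its world onto the core
# (`NoHeavyLowerTail` cell, stmt-CriticalPhenomena-4575; prover `prim-hp-2`, gen 19 — brick L3 of the semantic layer of THEOREM B,
# memo `run/shared/lean/prim/prim-hp-2/MEMO-gen17-lean-certificates.md` §4')

Support file (`--supports stmt-CriticalPhenomena-4575`; COMPUTATIONAL: one `native_decide` over the `2¹²` side configurations).
Small computable definitions (breadth-first parent tables in the certificate format of `…KNGoodGMgcGlueCongr`, the per-configuration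
check `sideCert`) + soundness; no named facts, no sorries.
* `sideCert c` — the open side edges (`openAbs c`) and the glue set of `sideWorld c` (`glueAbs`) are well-formed edge lists on the
  abstract vertices `0..5`, with admissible edge-constant parent maps, whose roots induce the same partition of the relays `3,4,5`;
  `sideCert_all` — it holds at all `2¹²` configurations (`native_decide`).
* **`Verts.real_openConn_force_side`** — under a pendant `u`, for every configuration `c` and all `p, q ∉ {x,y,z}`:
  `μ_{force u e 12 c}(p ↔ q) = μ_{glued u (sideWorld c)}(p ↔ q)` (`real_openConn_glue_congr` + `reachable_iff_of_cert`).
  With `…KNGoodGMgcSideDecomp.real_eq_bexpR_force` this expands every core reliability of `K` over the five worlds (sequel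
  `…KNGoodGMgcWorldMix.lean`).
-/

namespace Summit.CriticalPhenomena.PercolationContinuityZ3.Theorems

namespace KNGoodGMgc

open MeasureTheory Set Literature.Probability.LatticeModels Literature.Probability.Percolation
open scoped Classical

variable {n : ℕ}

/-! ## Breadth-first parent-pointer certificates (format of `…KNGoodGMgcGlueCongr`) -/

/-- Neighbours of `v` in an abstract edge list. [folklore] -/
def nbrs (E : List (ℕ × ℕ)) (v : ℕ) : List ℕ :=
  E.filterMap fun e => if e.1 = v then some e.2 else if e.2 = v then some e.1 else none

/-- One round of label propagation on a table (minimum over the closed neighbourhood). [folklore] -/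
def propMin (E : List (ℕ × ℕ)) (N : ℕ) (t : List ℕ) : List ℕ :=
  (List.range N).map fun v => ((nbrs E v).map fun w => t.getD w w).foldl min (t.getD v v)

/-- Component labels: the least vertex of each component (`N` rounds of propagation). [folklore] -/
def labTbl (E : List (ℕ × ℕ)) (N : ℕ) : List ℕ := (propMin E N)^[N] (List.range N)

/-- One round of distance relaxation towards the component's least vertex. [folklore] -/
def relaxD (E : List (ℕ × ℕ)) (N : ℕ) (lab : List ℕ) (d : List ℕ) : List ℕ :=
  (List.range N).map fun v =>
    if lab.getD v v = v then 0 else ((nbrs E v).map fun w => d.getD w N + 1).foldl min (d.getD v N)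

/-- Breadth-first distances to the component's least vertex (given the label table). [folklore] -/
def distTbl (E : List (ℕ × ℕ)) (N : ℕ) (lab : List ℕ) : List ℕ :=
  (relaxD E N lab)^[N] ((List.range N).map fun v => if lab.getD v v = v then 0 else N)

/-- Breadth-first parent table: the least vertex of a component points to itself, every other vertex to a neighbour one step
closer. [folklore] -/
def parTbl (E : List (ℕ × ℕ)) (N : ℕ) : List ℕ :=
  let lab := labTbl E N
  let d := distTbl E N lab
  (List.range N).map fun v =>
    if lab.getD v v = v then v else ((nbrs E v).filter fun w => d.getD w N < d.getD v N).headD v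

/-- The parent map of a parent table (identity outside the table). [folklore] -/
def parOf (t : List ℕ) (v : ℕ) : ℕ := t.getD v v

/-- The certificate check at one configuration: the open side edges and the glue set of `sideWorld c` are well-formed edge lists
with admissible, edge-constant parent maps whose roots induce the same partition of the relays `3,4,5`. [this work] -/
def sideCert (c : Cfg) : Bool :=
  let D := openAbs c
  let G := glueAbs (sideWorld c)
  let tD := parTbl D 6
  let tG := parTbl G 6
  edgesOK 6 D && edgesOK 6 G && parOK 6 D (parOf tD) && parOK 6 G (parOf tG) && labOK 6 D (parOf tD) && labOK 6 G (parOf tG) &&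
    ([3, 4, 5].all fun i => [3, 4, 5].all fun j =>
      (root 6 (parOf tD) i == root 6 (parOf tD) j) == (root 6 (parOf tG) i == root 6 (parOf tG) j))

/-- **The certificate table**: `sideCert` holds at all `2¹²` configurations. [this work] -/
theorem sideCert_all : ∀ b0 b1 b2 b3 b4 b5 b6 b7 b8 b9 b10 b11 : Bool,
    sideCert (mk12 b0 b1 b2 b3 b4 b5 b6 b7 b8 b9 b10 b11) = true := by
  native_decide

/-- `sideCert (trunc c)`. [this work] -/
theorem sideCert_trunc (c : Cfg) : sideCert (trunc c) = true :=
  sideCert_all (c 0) (c 1) (c 2) (c 3) (c 4) (c 5) (c 6) (c 7) (c 8) (c 9) (c 10) (c 11)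

/-! ## The side glue theorem -/

namespace Verts

variable (V : Verts n)

/-- A vertex off `{x,y,z}` is not the placement of an abstract vertex outside the relay indices `3,4,5`. [this work] -/
theorem ne_emb_of_not_mem {c₁ : Fin n} (h₁ : c₁ ∉ ({V.x, V.y, V.z} : Finset (Fin n))) :
    ∀ i : ℕ, i < 6 → i ∉ [3, 4, 5] → c₁ ≠ V.emb i := by
  intro i hi hiP h
  simp only [List.mem_cons, List.not_mem_nil, or_false, not_or] at hiP
  simp only [Finset.mem_insert, Finset.mem_singleton, not_or] at h₁
  interval_cases i
  · exact h₁.1 h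
  · exact h₁.2.1 h
  · exact h₁.2.2 h
  · exact hiP.1 rfl
  · exact hiP.2.1 rfl
  · exact hiP.2.2 rfl

/-- **Side glue.**  Under a pendant `u`, for every configuration `c` of the twelve side bits and all `p, q ∉ {x,y,z}`:
`μ_{force u e 12 c}(p ↔ q) = μ_{glued u (sideWorld c)}(p ↔ q)` — the forced side connects the core exactly as the glue set of
its world. [this work] -/
theorem real_openConn_force_side {u : Sym2 (Fin n) → unitInterval} (hP : V.Pendant u) (c : Cfg) (p q : Fin n)
    (hp : p ∉ ({V.x, V.y, V.z} : Finset (Fin n))) (hq : q ∉ ({V.x, V.y, V.z} : Finset (Fin n))) :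
    (prodBernoulli (force u V.e 12 c)).real (openConn p q) =
      (prodBernoulli (V.glued u (sideWorld c))).real (openConn p q) := by
  have hcc' : ∀ k, k < 12 → c k = trunc c k := fun k hk => (trunc_apply c k hk).symm
  rw [force_congr u V.e 12 c (trunc c) hcc', sideWorld_trunc c, V.force_side_eq hP (trunc c)]
  unfold Verts.glued
  refine real_openConn_glue_congr (V.core u) {V.x, V.y, V.z} (fun f hf => V.core_eq_zero u f hf)
    (cimg V.emb (openAbs (trunc c))) (cimg V.emb (glueAbs (sideWorld (trunc c)))) ?_ p q hp hq
  intro c₁ c₂ h₁ h₂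
  have hcert := sideCert_trunc c
  simp only [sideCert, Bool.and_eq_true] at hcert
  obtain ⟨⟨⟨⟨⟨⟨hD, hG⟩, hpD⟩, hpG⟩, hlD⟩, hlG⟩, hcmp⟩ := hcert
  refine reachable_iff_of_cert V.emb 6 V.emb_inj [3, 4, 5] _ _ (parOf (parTbl (openAbs (trunc c)) 6))
    (parOf (parTbl (glueAbs (sideWorld (trunc c))) 6)) hD hG hpD hpG hlD hlG ?_ (V.ne_emb_of_not_mem h₁) (V.ne_emb_of_not_mem h₂)
  intro i hi j hj
  have h1 := List.all_eq_true.1 hcmp i hi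
  have h2 := List.all_eq_true.1 h1 j hj
  exact beq_iff_eq.1 h2

end Verts

end KNGoodGMgc

end Summit.CriticalPhenomena.PercolationContinuityZ3.Theorems
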